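import Mathlib.RingTheory.Valuation.ValuationSubring
import Mathlib.RingTheory.LocalRing.ResidueField.Basic
import Mathlib.Combinatorics.SimpleGraph.Connectivity.Connected
import Mathlib.Data.ZMod.Basic
import Summits.Ventures.DiscreteObjects.UnitDistance.UnitCircleGraph
import Summits.Ventures.DiscreteObjects.UnitDistance.FiniteFieldColourings
import Summits.Ventures.DiscreteObjects.UnitDistance.CoordRingObstruction
import HarnessLib

/-!
# Madore's reduction principle over a valuation ring — the algebraic half of the field obstruction, for arbitrary coordinate fields

Framing (verbatim for the cell): lottery ticket; floor = certified bounds/negative ranges.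

The (U) census of cell `pub-namedobj` excludes coordinate fields for a 6-chromatic unit-distance graph by REDUCTION: if a field `K`
carries a valuation ring `O ⊆ K` whose residue field `k` has `−1` a non-square (for a number field: a prime of residue field
`F_q`, `q ≡ 3 (mod 4)`), then every unit vector `(a, b) ∈ K²`, `a² + b² = 1`, has `a, b ∈ O` (Madore, arXiv:1509.07023,
Prop. 3.1, first paragraph of the proof, `d = 2`), so along the edges of any unit-distance graph with coordinates in `K` the
coordinate DIFFERENCES are `O`-integral; translating each connected component to a base vertex and reducing modulo the maximal
ideal gives a graph homomorphism into `unitCircleGraph k`, whence `χ ≤ χ(unitCircleGraph k)` (Madore Prop. 3.1 / Cor. 3.2).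
The tree so far held only the coordinate-RING form (`UnitCircleGraph.homUnitCircleGraphOfRingHom`: coordinates already in a
ring `A` mapping to `ZMod p`; `CoordRingObstruction.lean` for `A = ℤ[1/6][√3,√5,√11]`), with the integrality step left in the md
files.  This file formalises that step in Mathlib's `ValuationSubring` language, for ANY field `K` and ANY graph coordinatised in
`K²` (vertices need not be integral, only edge differences turn out to be):

* `mem_valuationSubring_of_sq_add_sq_eq_one` — integrality of unit vectors (Madore's lemma);
* `homUnitCircleGraphOfValuationSubring` / `colorable_of_valuationSubring` — the graph homomorphism into
  `unitCircleGraph (ResidueField O)` and the colouring bound;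
* corollaries `colorable_{three,four,five}_of_valuationSubring_{zmod3,zmod7,zmod11,zmod19}` — combined with the kernel-checked
  colourings of `FiniteFieldColourings.lean` / `FiniteFieldObstruction.lean`: if the residue field maps to (`≅`) `ZMod 3`, `ZMod 7`,
  `ZMod 11` or `ZMod 19` (the four 'killer primes' of the census atlas TABLE-U3/U4: `χ(UD(F_p²)) ≤ 5` iff `p ∈ {3,7,11,19}` among
  primes `p ≡ 3 (mod 4)`), every unit-distance graph with coordinates in `K` is `3`-, `4`-, `5`-, `5`-colourable respectively.

Nothing here is cited as a new result: the mathematics is Madore's Prop. 3.1 (and the classical Woodall/Benda–Perles reduction idea);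
the content is the formalisation in the tree's vocabulary, closing the 'not formalised' caveats of `UnitCircleGraph.lean` and
`CoordRingObstruction.lean`.
-/

namespace Summit.Ventures.DiscreteObjects.UnitDistance

open SimpleGraph IsLocalRing

variable {K : Type*} [Field K] (O : ValuationSubring K)

/-! ## Integrality of unit vectors (Madore, arXiv:1509.07023, proof of Prop. 3.1, `d = 2`) -/

/-- Core case of Madore's lemma: it is impossible that `a² + b² = 1`, `a ∉ O` and `b/a ∈ O` when `−1` is not a square in the
residue field (reduce `(b/a)² + 1 = (1/a)²` modulo the maximal ideal: `1/a` lies in it). -/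
theorem false_of_sq_add_sq_eq_one_of_not_mem (hO : ∀ z : ResidueField O, z ^ 2 ≠ -1) {a b : K}
    (h : a ^ 2 + b ^ 2 = 1) (ha : a ∉ O) (hba : b * a⁻¹ ∈ O) : False := by
  have ha0 : a ≠ 0 := by rintro rfl; exact ha O.zero_mem
  -- `u = a⁻¹` lies in `O`, indeed in its maximal ideal
  have hu : a⁻¹ ∈ O.nonunits := (O.inv_mem_nonunits_iff).2 (Or.inr ha)
  obtain ⟨huO, humax⟩ := (ValuationSubring.mem_nonunits_iff_exists_mem_maximalIdeal).1 hu
  have hres_u : residue O ⟨a⁻¹, huO⟩ = 0 := (residue_eq_zero_iff _).2 humax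
  -- the identity `(b/a)² + 1 = (1/a)²` in `O`
  have hK : (b * a⁻¹) ^ 2 + 1 = (a⁻¹) ^ 2 := by
    field_simp
    linear_combination h
  have hOeq : (⟨b * a⁻¹, hba⟩ : O) ^ 2 + 1 = (⟨a⁻¹, huO⟩ : O) ^ 2 := by
    apply Subtype.ext
    simpa using hK
  have hk := congrArg (residue O) hOeq
  rw [map_add, map_pow, map_one, map_pow, hres_u, zero_pow two_ne_zero] at hk
  exact hO (residue O ⟨b * a⁻¹, hba⟩) (eq_neg_of_add_eq_zero_left hk)

/-- MADORE'S LEMMA (integrality of unit vectors).  If `−1` is not a square in the residue field of the valuation ring `O ⊆ K`,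
then every solution of `a² + b² = 1` in `K` has `a ∈ O` (and, by symmetry, `b ∈ O`: `mem_valuationSubring_of_sq_add_sq_eq_one`). -/
theorem fst_mem_valuationSubring_of_sq_add_sq_eq_one (hO : ∀ z : ResidueField O, z ^ 2 ≠ -1) {a b : K}
    (h : a ^ 2 + b ^ 2 = 1) : a ∈ O := by
  by_contra ha
  have ha0 : a ≠ 0 := by rintro rfl; exact ha O.zero_mem
  rcases O.mem_or_inv_mem (b * a⁻¹) with hba | hab
  · exact false_of_sq_add_sq_eq_one_of_not_mem O hO h ha hba
  · -- `(b/a)⁻¹ = a/b ∈ O`; then `b ∉ O` (else `a = (a/b)·b ∈ O`) and the core case applies with the roles swapped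
    have hb0 : b ≠ 0 := by
      rintro rfl
      have : a * a = 1 := by rw [← sq]; simpa using h
      rcases mul_self_eq_one_iff.mp this with rfl | rfl
      · exact ha O.one_mem
      · exact ha (neg_mem O.one_mem)
    have hab' : a * b⁻¹ ∈ O := by
      have : (b * a⁻¹)⁻¹ = a * b⁻¹ := by rw [mul_inv_rev, inv_inv, mul_comm]
      rwa [this] at hab
    have hb : b ∉ O := by
      intro hbO
      apply ha
      have : a = a * b⁻¹ * b := by rw [mul_assoc, inv_mul_cancel₀ hb0, mul_one]
      rw [this]
      exact mul_mem hab' hbO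
    exact false_of_sq_add_sq_eq_one_of_not_mem O hO (by rw [add_comm]; exact h) hb hab'

/-- MADORE'S LEMMA, both coordinates: `a² + b² = 1` in `K` forces `a, b ∈ O` when `−1` is a non-square in the residue field. -/
theorem mem_valuationSubring_of_sq_add_sq_eq_one (hO : ∀ z : ResidueField O, z ^ 2 ≠ -1) {a b : K}
    (h : a ^ 2 + b ^ 2 = 1) : a ∈ O ∧ b ∈ O :=
  ⟨fst_mem_valuationSubring_of_sq_add_sq_eq_one O hO h,
    fst_mem_valuationSubring_of_sq_add_sq_eq_one O hO (by rw [add_comm]; exact h)⟩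

/-! ## The reduction homomorphism (Madore Prop. 3.1 / Cor. 3.2 for an arbitrary coordinatised graph) -/

section Graph

variable {V : Type*} {G : SimpleGraph V} (p : V → K × K)

/-- Along a walk of a graph coordinatised in `K²` with unit-distance edges, the coordinate difference of the endpoints is
`O`-integral (each edge step is, by Madore's lemma, and `O` is closed under addition). -/
theorem diff_mem_of_walk (hO : ∀ z : ResidueField O, z ^ 2 ≠ -1)
    (hadj : ∀ ⦃v w : V⦄, G.Adj v w → ((p v).1 - (p w).1) ^ 2 + ((p v).2 - (p w).2) ^ 2 = 1)
    {u v : V} (q : G.Walk u v) : (p v).1 - (p u).1 ∈ O ∧ (p v).2 - (p u).2 ∈ O := by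
  induction q with
  | nil => simp [O.zero_mem]
  | @cons u x w hux _ ih =>
    obtain ⟨h1, h2⟩ := mem_valuationSubring_of_sq_add_sq_eq_one O hO (hadj hux)
    refine ⟨?_, ?_⟩
    · have e : (p w).1 - (p u).1 = ((p w).1 - (p x).1) + -((p u).1 - (p x).1) := by ring
      rw [e]; exact add_mem ih.1 (neg_mem h1)
    · have e : (p w).2 - (p u).2 = ((p w).2 - (p x).2) + -((p u).2 - (p x).2) := by ring
      rw [e]; exact add_mem ih.2 (neg_mem h2)

/-- A base vertex in the connected component of `v` (a choice of representative). -/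
noncomputable def baseVertex (G : SimpleGraph V) (v : V) : V := Quot.out (G.connectedComponentMk v)

/-- The base vertex of `v`'s component is reachable from `v` (it represents the same component). -/
theorem baseVertex_reachable (G : SimpleGraph V) (v : V) : G.Reachable (baseVertex G v) v :=
  ConnectedComponent.exact (Quot.out_eq (G.connectedComponentMk v))

/-- Adjacent vertices have the same base vertex (same connected component). -/
theorem baseVertex_eq_of_adj {G : SimpleGraph V} {v w : V} (h : G.Adj v w) : baseVertex G v = baseVertex G w := by
  unfold baseVertex
  rw [ConnectedComponent.sound h.reachable]

/-- Coordinates re-centred at the base vertex of each component: these ARE `O`-integral. -/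
noncomputable def centredCoord (G : SimpleGraph V) (p : V → K × K) (v : V) : K × K := p v - p (baseVertex G v)

/-- The centred coordinates of every vertex lie in `O × O` (integrality along a walk from the base vertex). -/
theorem centredCoord_mem (hO : ∀ z : ResidueField O, z ^ 2 ≠ -1)
    (hadj : ∀ ⦃v w : V⦄, G.Adj v w → ((p v).1 - (p w).1) ^ 2 + ((p v).2 - (p w).2) ^ 2 = 1) (v : V) :
    (centredCoord G p v).1 ∈ O ∧ (centredCoord G p v).2 ∈ O := by
  obtain ⟨q⟩ := baseVertex_reachable G v
  simpa [centredCoord] using diff_mem_of_walk O p hO hadj q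

open scoped Classical in
/-- The residue map extended to all of `K` (junk value `0` off `O`); only ever evaluated on elements of `O`. -/
noncomputable def residueK (x : K) : ResidueField O :=
  if h : x ∈ O then residue O ⟨x, h⟩ else 0

/-- On `O` the extended residue map is the residue map. -/
theorem residueK_of_mem {x : K} (h : x ∈ O) : residueK O x = residue O ⟨x, h⟩ := by
  rw [residueK, dif_pos h]

/-- The extended residue map is compatible with subtraction on `O`. -/
theorem residueK_sub {x y : K} (hx : x ∈ O) (hy : y ∈ O) :
    residueK O x - residueK O y = residue O ⟨x - y, sub_mem hx hy⟩ := by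
  rw [residueK_of_mem O hx, residueK_of_mem O hy, ← map_sub]
  rfl

/-- THE REDUCTION HOMOMORPHISM (Madore Prop. 3.1, `d = 2`, for an arbitrary coordinatised graph).  If `−1` is not a square in
the residue field `k` of the valuation ring `O ⊆ K`, every graph whose vertices carry `K²`-coordinates with adjacent vertices at
unit distance maps homomorphically to `unitCircleGraph k`: re-centre each component at a base vertex (differences along edges
are `O`-integral) and reduce modulo the maximal ideal. -/
noncomputable def homUnitCircleGraphOfValuationSubring (hO : ∀ z : ResidueField O, z ^ 2 ≠ -1)
    (hadj : ∀ ⦃v w : V⦄, G.Adj v w → ((p v).1 - (p w).1) ^ 2 + ((p v).2 - (p w).2) ^ 2 = 1) :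
    G →g unitCircleGraph (ResidueField O) where
  toFun v := (residueK O (centredCoord G p v).1, residueK O (centredCoord G p v).2)
  map_rel' := by
    intro v w hvw
    obtain ⟨hv1, hv2⟩ := centredCoord_mem O p hO hadj v
    obtain ⟨hw1, hw2⟩ := centredCoord_mem O p hO hadj w
    have hb : baseVertex G w = baseVertex G v := (baseVertex_eq_of_adj hvw).symm
    -- the difference of the centred coordinates is the honest coordinate difference
    have d1 : (centredCoord G p v).1 - (centredCoord G p w).1 = (p v).1 - (p w).1 := by
      simp only [centredCoord, Prod.fst_sub, hb]; ring
    have d2 : (centredCoord G p v).2 - (centredCoord G p w).2 = (p v).2 - (p w).2 := by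
      simp only [centredCoord, Prod.snd_sub, hb]; ring
    obtain ⟨hd1, hd2⟩ := mem_valuationSubring_of_sq_add_sq_eq_one O hO (hadj hvw)
    -- the unit-distance identity holds in `O`, hence in the residue field
    have hOeq : (⟨(p v).1 - (p w).1, hd1⟩ : O) ^ 2 + (⟨(p v).2 - (p w).2, hd2⟩ : O) ^ 2 = 1 := by
      apply Subtype.ext
      simpa using hadj hvw
    have hk := congrArg (residue O) hOeq
    rw [map_add, map_pow, map_pow, map_one] at hk
    have e1 : residueK O (centredCoord G p v).1 - residueK O (centredCoord G p w).1 =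
        residue O ⟨(p v).1 - (p w).1, hd1⟩ := by
      rw [residueK_sub O hv1 hw1]; congr 1; exact Subtype.ext d1
    have e2 : residueK O (centredCoord G p v).2 - residueK O (centredCoord G p w).2 =
        residue O ⟨(p v).2 - (p w).2, hd2⟩ := by
      rw [residueK_sub O hv2 hw2]; congr 1; exact Subtype.ext d2
    have key : (residueK O (centredCoord G p v).1 - residueK O (centredCoord G p w).1) ^ 2 +
        (residueK O (centredCoord G p v).2 - residueK O (centredCoord G p w).2) ^ 2 = 1 := by
      rw [e1, e2]; exact hk
    exact ⟨ne_of_sq_add_sq_eq_one key, key⟩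

/-- MADORE'S REDUCTION PRINCIPLE (colouring form, Prop. 3.1 / Cor. 3.2 of arXiv:1509.07023 in the tree's vocabulary): with `O ⊆ K`
a valuation ring whose residue field `k` has `−1` a non-square, every graph coordinatised in `K²` with unit-distance edges is
`n`-colourable as soon as `unitCircleGraph k` is.  For a number field and a prime of residue field `F_q`, `q ≡ 3 (mod 4)`, this is
`χ(K²) ≤ χ(UD(F_q²))`. -/
theorem colorable_of_valuationSubring (hO : ∀ z : ResidueField O, z ^ 2 ≠ -1)
    (hadj : ∀ ⦃v w : V⦄, G.Adj v w → ((p v).1 - (p w).1) ^ 2 + ((p v).2 - (p w).2) ^ 2 = 1) {n : ℕ}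
    (hk : (unitCircleGraph (ResidueField O)).Colorable n) : G.Colorable n :=
  hk.of_hom (homUnitCircleGraphOfValuationSubring O p hO hadj)

/-- Variant through a further ring homomorphism of the residue field (e.g. an isomorphism `k ≃+* ZMod p`): if `unitCircleGraph B`
is `n`-colourable for some nontrivial `B` receiving `k`, so is every graph coordinatised in `K²` with unit-distance edges. -/
theorem colorable_of_valuationSubring_of_ringHom (hO : ∀ z : ResidueField O, z ^ 2 ≠ -1)
    (hadj : ∀ ⦃v w : V⦄, G.Adj v w → ((p v).1 - (p w).1) ^ 2 + ((p v).2 - (p w).2) ^ 2 = 1)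
    {B : Type*} [CommRing B] [Nontrivial B] (ρ : ResidueField O →+* B) {n : ℕ}
    (hB : (unitCircleGraph B).Colorable n) : G.Colorable n :=
  colorable_of_valuationSubring O p hO hadj (unitCircleGraph_colorable_of_ringHom ρ hB)

/-! ## The four killer primes of the atlas: residue field `F₃`, `F₇`, `F₁₁`, `F₁₉` -/

/-- In `ZMod p` with `p ∈ {3, 7, 11, 19}` (all `≡ 3 (mod 4)`), `−1` is not a square — by kernel computation. -/
theorem zmod3_sq_ne_neg_one : ∀ z : ZMod 3, z ^ 2 ≠ -1 := by decide
/-- `−1` is not a square in `ZMod 7`. -/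
theorem zmod7_sq_ne_neg_one : ∀ z : ZMod 7, z ^ 2 ≠ -1 := by decide
/-- `−1` is not a square in `ZMod 11`. -/
theorem zmod11_sq_ne_neg_one : ∀ z : ZMod 11, z ^ 2 ≠ -1 := by decide
/-- `−1` is not a square in `ZMod 19`. -/
theorem zmod19_sq_ne_neg_one : ∀ z : ZMod 19, z ^ 2 ≠ -1 := by decide

/-- Transport of the non-square hypothesis along a ring homomorphism `k →+* B`: if `−1` is a non-square in `B` it is one
in `k` (a square root of `−1` in `k` would map to one in `B`). -/
theorem sq_ne_neg_one_of_ringHom {k B : Type*} [CommRing k] [CommRing B] (ρ : k →+* B)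
    (hB : ∀ z : B, z ^ 2 ≠ -1) : ∀ z : k, z ^ 2 ≠ -1 := by
  intro z hz
  apply hB (ρ z)
  have := congrArg ρ hz
  simpa using this

/-- RESIDUE FIELD `F₃`: every unit-distance graph coordinatised in a field `K` having a valuation ring with residue field mapping to
(`≅`) `ZMod 3` (e.g. `ℚ(√3)`, `ℚ(√7)`, `ℚ(√3,√7,√13)`: a degree-one prime over `3`) is `3`-colourable — `χ(K²) ≤ 3`. -/
theorem colorable_three_of_valuationSubring_zmod3 (ρ : ResidueField O →+* ZMod 3)
    (hadj : ∀ ⦃v w : V⦄, G.Adj v w → ((p v).1 - (p w).1) ^ 2 + ((p v).2 - (p w).2) ^ 2 = 1) : G.Colorable 3 :=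
  haveI : Fact (1 < 3) := ⟨by norm_num⟩
  colorable_of_valuationSubring_of_ringHom O p (sq_ne_neg_one_of_ringHom ρ zmod3_sq_ne_neg_one) hadj ρ
    unitCircleGraph_zmod3_colorable_three

/-- RESIDUE FIELD `F₇`: residue field mapping to `ZMod 7` (e.g. `ℚ(√2)`, `ℚ(√11)`, `ℚ(√2,√7,√11)`) ⇒ `4`-colourable — `χ(K²) ≤ 4`. -/
theorem colorable_four_of_valuationSubring_zmod7 (ρ : ResidueField O →+* ZMod 7)
    (hadj : ∀ ⦃v w : V⦄, G.Adj v w → ((p v).1 - (p w).1) ^ 2 + ((p v).2 - (p w).2) ^ 2 = 1) : G.Colorable 4 :=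
  haveI : Fact (1 < 7) := ⟨by norm_num⟩
  colorable_of_valuationSubring_of_ringHom O p (sq_ne_neg_one_of_ringHom ρ zmod7_sq_ne_neg_one) hadj ρ
    unitCircleGraph_zmod7_colorable_four

/-- RESIDUE FIELD `F₁₁` (the census obstruction: Heule's field `ℚ(√3,√5,√11)`, the Exoo–Ismailescu field `ℚ(√3,√11,√247)`,
`ℚ(√3,√5)`, …): residue field mapping to `ZMod 11` ⇒ `5`-colourable — `χ(K²) ≤ 5`, no 6-chromatic unit-distance graph has
coordinates in such a field. -/
theorem colorable_five_of_valuationSubring_zmod11 (ρ : ResidueField O →+* ZMod 11)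
    (hadj : ∀ ⦃v w : V⦄, G.Adj v w → ((p v).1 - (p w).1) ^ 2 + ((p v).2 - (p w).2) ^ 2 = 1) : G.Colorable 5 :=
  colorable_of_valuationSubring_of_ringHom O p (sq_ne_neg_one_of_ringHom ρ zmod11_sq_ne_neg_one) hadj ρ
    unitCircleGraph_zmod11_colorable_five

/-- RESIDUE FIELD `F₁₉` (`ℚ(√5,√7)`, `ℚ(√5,√7,√11)`, …): residue field mapping to `ZMod 19` ⇒ `5`-colourable — `χ(K²) ≤ 5`. -/
theorem colorable_five_of_valuationSubring_zmod19 (ρ : ResidueField O →+* ZMod 19)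
    (hadj : ∀ ⦃v w : V⦄, G.Adj v w → ((p v).1 - (p w).1) ^ 2 + ((p v).2 - (p w).2) ^ 2 = 1) : G.Colorable 5 :=
  haveI : Fact (1 < 19) := ⟨by norm_num⟩
  colorable_of_valuationSubring_of_ringHom O p (sq_ne_neg_one_of_ringHom ρ zmod19_sq_ne_neg_one) hadj ρ
    unitCircleGraph_zmod19_colorable_five

end Graph

/-- Special case `G = unitCircleGraph K` itself (Madore's `χ(K²) ≤ χ(k²)`): the unit-circle graph of the FIELD `K` is
`n`-colourable whenever that of the residue field of a valuation ring `O ⊆ K` with `−1` a non-square in it is. -/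
theorem unitCircleGraph_colorable_of_valuationSubring (hO : ∀ z : ResidueField O, z ^ 2 ≠ -1) {n : ℕ}
    (hk : (unitCircleGraph (ResidueField O)).Colorable n) : (unitCircleGraph K).Colorable n :=
  colorable_of_valuationSubring O (G := unitCircleGraph K) id hO (fun _ _ h => h.2) hk

end Summit.Ventures.DiscreteObjects.UnitDistance
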